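import Literature.Geometry.Riemannian.Sigma2ConformalFour
import Literature.Geometry.Riemannian.GurskyViaclovskyPath
import Literature.Geometry.Lorentzian.WeylConformal
import HarnessLib

/-!
# The conformal invariance of `κ(h) = ∫σ₂(A_h) dV_h − ¼∫|W_h|² dV_h` on closed four-manifolds,
# without the Chern–Gauss–Bonnet formula

`GurskyViaclovskyPath.kappa h = ∫_M σ₂(A_h) dV_h − ¼ ∫_M |W_h|²_h dV_h` is the real number on the
left-hand side of Chang–Gursky–Yang 2003, (1.2) (their assumption `∫σ₂(A) > ¼∫|W|²` of Thm. 1.4 /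
Thm. A). Its conformal invariance — "the conformal invariance of the Weyl tensor implies that the
quantity `∫σ₂(A) dvol` is conformally invariant as well" (ibid. p. 111, there via the
Chern–Gauss–Bonnet formula (1.1)) — was deliberately NOT vended by `GurskyViaclovskyPath.lean`
("it needs Chern–Gauss–Bonnet, the named fact `chernGaussBonnet_four`"). This file PROVES it
without Chern–Gauss–Bonnet, from

* `sigma2WeylSchoutenIntegral_eq_of_isConformalTo` (`Sigma2ConformalFour.lean`: the transformation
  law of `A` under `g ↦ e^{2w} g`, the integrated Bochner formula, Green's identity and the weak
  contracted Bianchi identity of `RicciHessianDivergence.lean`), and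
* `weylEnergy_conformal_sq_four` (`Lorentzian/WeylConformal.lean`: the pointwise conformal
  invariance `|W_{ψ²g}|² dV_{ψ²g} = |W_g|² dV_g` in dimension four):

`sigma2WeylSchoutenIntegral_conformal_sq` (the `h = ψ²g` form, free of measurable-space instances —
the CGB-free replacement of the `gv-continuity-path` line's `sigma2WeylSchoutenIntegral_conformal`),
`weylEnergy_eq_of_isConformalTo` (`∫|W|² dV` depends only on the conformal class),
**`kappa_eq_of_isConformalTo`** (`κ(h) = κ(g)` for `h ∈ [g]`, both `C^∞` Riemannian metrics on a
closed `4`-manifold), `kappa_conformal_exp` (`h = e^{2w} g`) and `IsPathSolution.kappa_eq` (along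
the Gursky–Viaclovsky continuity path `h = e^{−2u} g` the invariant is constant — the form used by
the `gv-continuity-path` line: the hypothesis `κ > 0` of Chang–Gursky–Yang's Thm. 1.4 passes to
every metric of the path).

Everything is proved; no definition and no named fact is introduced.

## References

* S.-Y. A. Chang, M. J. Gursky, P. C. Yang, *A conformally invariant sphere theorem in four
  dimensions*, Publ. Math. IHÉS 98 (2003) 105–143, §1, (1.1)–(1.2), p. 111. [ChangGurskyYang2003]
* M. J. Gursky, J. A. Viaclovsky, *A fully nonlinear equation on four-manifolds with positive
  scalar curvature*, J. Differential Geom. 63 (2003) 131–154, §5 (the set `𝒮`). [GurskyViaclovsky2003]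
-/

noncomputable section

open Bundle MeasureTheory Set Filter Function
open scoped Manifold ContDiff Topology ENNReal

namespace Literature.Geometry.Riemannian

open Lorentzian Lorentzian.PseudoRiemannianMetric

variable {M : Type*} [TopologicalSpace M] [T2Space M] [SecondCountableTopology M]
  [CompactSpace M] [ChartedSpace (EuclideanSpace ℝ (Fin 4)) M] [IsManifold (𝓡 4) ∞ M]
  (g h : PseudoRiemannianMetric (𝓡 4) ∞ (EuclideanSpace ℝ (Fin 4)) (TangentSpace (𝓡 4) : M → Type _))
  [g.HasLeviCivita] [h.HasLeviCivita]

/-- **`∫σ₂(A_{ψ²g}) dV_{ψ²g} = ∫σ₂(A_g) dV_g`** on a closed `4`-manifold for a `C^∞` Riemannian `g`,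
a `C^∞` metric `h` and `ψ > 0` smooth with `h = ψ² g` — the form of the conformal invariance of
`∫σ₂(A) dV` used by the Gursky–Viaclovsky path (`h = e^{−2u} g`, `ψ = e^{−u}`), free of measurable-space
instances (the integrals are taken against the Borel structure), and proved WITHOUT the
Chern–Gauss–Bonnet formula (`sigma2WeylSchoutenIntegral_conformal_exp_eq` with `w = log ψ`).
Chang–Gursky–Yang 2003, p. 111. [cite: ChangGurskyYang2003, §1, p. 111] -/
theorem sigma2WeylSchoutenIntegral_conformal_sq (hg : g.IsRiemannian) {ψ : M → ℝ}
    (hψ : ContMDiff (𝓡 4) 𝓘(ℝ) ∞ ψ) (hpos : ∀ x, 0 < ψ x)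
    (hgh : ∀ (x : M) (v w : TangentSpace (𝓡 4) x), h.val x v w = ψ x ^ 2 * g.val x v w) :
    h.sigma2WeylSchoutenIntegral = g.sigma2WeylSchoutenIntegral := by
  letI : MeasurableSpace M := borel M
  haveI : BorelSpace M := ⟨rfl⟩
  have hh : h.IsRiemannian := fun y v hv ↦ by
    rw [hgh]
    exact mul_pos (pow_pos (hpos y) 2) (hg y v hv)
  have hw : ContMDiff (𝓡 4) 𝓘(ℝ) ∞ (fun x ↦ Real.log (ψ x)) := fun x ↦
    (Real.contDiffAt_log.mpr (hpos x).ne').comp_contMDiffAt (hψ x)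
  refine sigma2WeylSchoutenIntegral_conformal_exp_eq g h hg hh hw fun x v v' ↦ ?_
  rw [hgh x v v', show 2 * Real.log (ψ x) = Real.log (ψ x) + Real.log (ψ x) by ring, Real.exp_add,
    Real.exp_log (hpos x), sq]

namespace GurskyViaclovskyPath

omit [SecondCountableTopology M] in
/-- **`∫|W|² dV` depends only on the conformal class** on a closed `4`-manifold: for `C^∞`
Riemannian metrics `g`, `h` with `h ∈ [g]`, `weylEnergy h = weylEnergy g` — the conformal factor
`φ` is smooth (`contMDiff_conformalFactor_one`), `h = ψ² g` with `ψ = √φ`, and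
`weylEnergy_conformal_sq_four`. Chang–Gursky–Yang 2003, p. 111 ("the conformal invariance of the
Weyl tensor"). [cite: ChangGurskyYang2003, §1, p. 111] -/
theorem weylEnergy_eq_of_isConformalTo (hg : g.IsRiemannian) (hh : h.IsRiemannian)
    (hconf : IsConformalTo (h.toContMDiffRiemannianMetric hh) (g.toContMDiffRiemannianMetric hg)) :
    h.weylEnergy = g.weylEnergy := by
  letI : MeasurableSpace M := borel M
  haveI : BorelSpace M := ⟨rfl⟩
  obtain ⟨φ, hφ⟩ := hconf
  have hφpos : ∀ x, 0 < φ x := fun x ↦ (hφ x).1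
  have hconf' : ∀ (x : M) (v w : TangentSpace (𝓡 4) x), h.val x v w = φ x * g.val x v w :=
    fun x v w ↦ (hφ x).2 v w
  have hφs : ContMDiff (𝓡 4) 𝓘(ℝ, ℝ) ∞ φ := contMDiff_conformalFactor_one g h hg hconf'
  set ψ : M → ℝ := fun x ↦ Real.sqrt (φ x) with hψdef
  have hψpos : ∀ x, 0 < ψ x := fun x ↦ Real.sqrt_pos.2 (hφpos x)
  have hψsq : ∀ x, ψ x ^ 2 = φ x := fun x ↦ Real.sq_sqrt (hφpos x).le
  have hψs : ContMDiff (𝓡 4) 𝓘(ℝ) ∞ ψ := fun x ↦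
    (Real.contDiffAt_sqrt (hφpos x).ne').comp_contMDiffAt (hφs x)
  have hconfψ : ∀ (x : M) (v w : TangentSpace (𝓡 4) x), h.val x v w = ψ x ^ 2 * g.val x v w :=
    fun x v w ↦ by rw [hψsq]; exact hconf' x v w
  exact weylEnergy_conformal_sq_four g h hg hψs hψpos hconfψ

/-- **`κ` is a conformal invariant** (Chang–Gursky–Yang 2003, p. 111, (1.1)–(1.2); here WITHOUT the
Chern–Gauss–Bonnet formula): for `C^∞` Riemannian metrics `g`, `h` on a closed `4`-manifold with
`h ∈ [g]`, `kappa h = kappa g` (`sigma2WeylSchoutenIntegral_eq_of_isConformalTo`,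
`weylEnergy_eq_of_isConformalTo`). [cite: ChangGurskyYang2003, §1, p. 111] -/
theorem kappa_eq_of_isConformalTo (hg : g.IsRiemannian) (hh : h.IsRiemannian)
    (hconf : IsConformalTo (h.toContMDiffRiemannianMetric hh) (g.toContMDiffRiemannianMetric hg)) :
    kappa h = kappa g := by
  letI : MeasurableSpace M := borel M
  haveI : BorelSpace M := ⟨rfl⟩
  rw [kappa, kappa, sigma2WeylSchoutenIntegral_eq_of_isConformalTo g h hg hh hconf,
    weylEnergy_eq_of_isConformalTo g h hg hh hconf]

/-- **`κ(e^{2w} g) = κ(g)`** for a `C^∞` Riemannian metric `g` on a closed `4`-manifold, a `C^∞`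
metric `h` and any function `w` with `h = e^{2w} g` on each fibre (`h` is then Riemannian and
conformal to `g`). [cite: ChangGurskyYang2003, §1, p. 111] -/
theorem kappa_conformal_exp (hg : g.IsRiemannian) {w : M → ℝ}
    (hgh : ∀ (x : M) (v v' : TangentSpace (𝓡 4) x), h.val x v v' = Real.exp (2 * w x) * g.val x v v') :
    kappa h = kappa g := by
  have hh : h.IsRiemannian := fun x v hv ↦ by
    rw [hgh]
    exact mul_pos (Real.exp_pos _) (hg x v hv)
  refine kappa_eq_of_isConformalTo g h hg hh ⟨fun x ↦ Real.exp (2 * w x), fun x ↦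
    ⟨Real.exp_pos _, fun v v' ↦ hgh x v v'⟩⟩

/-- **`κ` is constant along the Gursky–Viaclovsky path**: for a path solution `h = e^{−2u} g`
(`IsPathSolution g h u t q`, Gursky–Viaclovsky 2003, §5) on a closed `4`-manifold with `C^∞`
background `g`, `kappa h = kappa g`; in particular Chang–Gursky–Yang's hypothesis `κ(g) > 0` of
Thm. 1.4 holds for every metric of the path. [cite: ChangGurskyYang2003, §1, p. 111]
[cite: GurskyViaclovsky2003, §5 (the set 𝒮)] -/
theorem IsPathSolution.kappa_eq {u : M → ℝ} {t : ℝ} {q : M → ℝ} (hs : IsPathSolution g h u t q) :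
    kappa h = kappa g :=
  kappa_conformal_exp g h hs.isRiemannian_background (w := fun x ↦ -u x) fun x v v' ↦ by
    rw [hs.val_eq x v v']
    congr 2
    ring

end GurskyViaclovskyPath

end Literature.Geometry.Riemannian

end
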